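import Summits.BirchSwinnertonDyer.BirchSwinnertonDyer.Theorems.ByReductionTypeAtTwoFlatWitnessNonsquare
import Mathlib.NumberTheory.LSeries.PrimesInAP
import Mathlib.NumberTheory.LegendreSymbol.QuadraticReciprocity
import HarnessLib

/-!
# Route `ByReductionTypeAtTwo` (K4), crux `OrdMissingLowerBoundAtTwo` (stmt-BirchSwinnertonDyer-19577), line
# `kato-free-lower-sandwich-two` — the flat witness (W) where `−1` IS a square mod `N`: two elliptic elements and a
# Dirichlet prime `ℓ ≡ 7 (mod 8)`, `ℓ ≡ √−1 (mod N)` (`--supports`; closes the registered stub `stub_flatWitnessAtTwoComposite`)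

Cell `bsd-2adic`, lead `cruxlead-stmt-BirchSwinnertonDyer-19577` (g2).  THEOREMS ONLY — no definition, no named fact, no
`sorry`; BSD is not proved by any of this.

With `ByReductionTypeAtTwoFlatWitnessPrime` (prime levels, `N = 1`) and `ByReductionTypeAtTwoFlatWitnessNonsquare` (`−1` not a
square) this file PROVES the flat witness (W) AT EVERY ODD LEVEL (`flatWitnessAtTwo`), hence the registered stub
`stub_flatWitnessAtTwoComposite` of skeleton v9 verbatim.  The remaining case — `−1` a square mod `N`, the family carrying
the 196 «product» levels `≤ 30000` of crux-triage r1-2 §N2 — is settled UNIFORMLY: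

* `S = ⟨u : u² = −1⟩ ≤ (ℤ/N)ˣ` (every element has square `±1`, `sq_mem_closure_roots`), `H = {u : u^{3N} ∈ S}` is ADMISSIBLE
  (`gamma0Map_trichotomy_of_killed`: a killed `d` has `d^{3N} = ±1` or `d² = −1`); `r` = order of `2` modulo `H`, so
  `2ᵉ ∈ H ⟺ r ∣ e`, and `w = 2^{3Nr} ∈ S`.
* if `w² = −1`: the order-`4` element `(−2^{3Nr}, −n; N, 2^{3Nr})` is a single witness (`k = 3Nr`, `gcd(k,4) = gcd(r,4) ∣ r`);
* if `w² = 1`: DIRICHLET (`Nat.forall_exists_prime_gt_and_eq_mod`, modulus `8N`) gives a prime `ℓ ≡ 7 (mod 8)` with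
  `ℓ ≡ √−1 (mod N)`; `2` is a square mod `ℓ` (`ZMod.exists_sq_eq_two_iff`), so `2^m ≡ 1 (mod ℓ)` with `m = (ℓ−1)/2` ODD; put
  `k = 3N·r·m` (so `ℓ ∣ 2ᵏ − 1 = ℓT`, `4ᵏ ≡ 1 (mod N)`, `gcd(k, 4) = gcd(r, 4)`), `d₂ = ℓ − T`: then `d₂² ≡ −1 (mod N)` and the
  product of the two order-`4` elements `(−ℓ, −1; ℓ² + 1, ℓ)·(−d₂, −1; d₂² + 1, d₂)` has lower-right entry `ℓ(d₂ − ℓ) − 1 = −2ᵏ`.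
-/

set_option linter.dupNamespace false
set_option autoImplicit false

namespace Summit.BirchSwinnertonDyer.BirchSwinnertonDyer.Theorems.FlatWitnessTwo

open scoped MatrixGroups
open CongruenceSubgroup Literature.NumberTheory.EllipticCurves.Rank1Residual
  Literature.NumberTheory.EllipticCurves.ModularForms

section Square

/-- For a killed `γ ∈ Γ₀(N)` (finite order or trace `±2`), `N` odd: `d(γ)^{3N} ≡ 1`, `≡ −1`, or `d(γ)² ≡ −1 (mod N)`.
[cite: Manin1972, Prop. 1.4] -/
theorem gamma0Map_trichotomy_of_killed {N : ℕ} (hN : Odd N) (γ : Gamma0 N)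
    (hγ : IsOfFinOrder γ ∨ trEntry γ = 2 ∨ trEntry γ = -2) :
    Gamma0Map N γ ^ (3 * N) = 1 ∨ Gamma0Map N γ ^ (3 * N) = -1 ∨ Gamma0Map N γ ^ 2 = -1 := by
  rcases gamma0Map_cases_of_killed γ hγ with h | h | h | h | h
  · left; rw [mul_comm, pow_mul, pow_eq_one_of_sub_one_sq _ h, one_pow]
  · right; left; rw [mul_comm, pow_mul, pow_eq_neg_one_of_add_one_sq hN _ h]; norm_num
  · right; right; linear_combination h
  · right; left
    have h3 : Gamma0Map N γ ^ 3 = -1 := by linear_combination (Gamma0Map N γ + 1) * h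
    rw [pow_mul, h3, hN.neg_one_pow]
  · left
    have h3 : Gamma0Map N γ ^ 3 = 1 := by linear_combination (Gamma0Map N γ - 1) * h
    rw [pow_mul, h3, one_pow]

/-- Every element of the subgroup of `(ℤ/N)ˣ` generated by the square roots of `−1` has square `±1`. [folklore] -/
theorem sq_mem_closure_roots {N : ℕ} {s : (ZMod N)ˣ}
    (hs : s ∈ Subgroup.closure {u : (ZMod N)ˣ | (u : ZMod N) ^ 2 = -1}) :
    (s : ZMod N) ^ 2 = 1 ∨ (s : ZMod N) ^ 2 = -1 := by
  induction hs using Subgroup.closure_induction with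
  | mem x hx => exact Or.inr hx
  | one => left; simp
  | mul x y _ _ hx hy =>
    rw [Units.val_mul, mul_pow]
    rcases hx with h | h <;> rcases hy with h' | h' <;> rw [h, h'] <;> norm_num
  | inv x _ hx =>
    have hxinv : ((x⁻¹ : (ZMod N)ˣ) : ZMod N) ^ 2 * (x : ZMod N) ^ 2 = 1 := by
      rw [← mul_pow, Units.inv_mul, one_pow]
    rcases hx with h | h <;> rw [h] at hxinv
    · left; simpa using hxinv
    · right; linear_combination -hxinv

/-- The order-`4` element `(−d, −1; d² + 1, d) ∈ SL(2, ℤ)`. [cite: Manin1972, Prop. 1.4] -/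
theorem det_ell4 (d : ℤ) : Matrix.det !![-d, -1; d ^ 2 + 1, d] = 1 := by
  rw [Matrix.det_fin_two_of]; ring

/-- `(−d, −1; d² + 1, d) ∈ Γ₀(N)` when `N ∣ d² + 1`, and it has finite order (trace `0`). [cite: Manin1972, Prop. 1.4] -/
theorem exists_ell4 (N : ℕ) (d n : ℤ) (h : d ^ 2 + 1 = n * N) :
    ∃ ε : Gamma0 N, IsOfFinOrder ε ∧ ((ε : SL(2, ℤ)) : Matrix (Fin 2) (Fin 2) ℤ) = !![-d, -1; d ^ 2 + 1, d] := by
  set γ₀ : SL(2, ℤ) := ⟨!![-d, -1; d ^ 2 + 1, d], det_ell4 d⟩ with hγ₀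
  have hmem : γ₀ ∈ Gamma0 N := by
    rw [Gamma0_mem, hγ₀]
    simp only [Fin.isValue, Matrix.of_apply, Matrix.cons_val', Matrix.cons_val_zero, Matrix.cons_val_one]
    exact (ZMod.intCast_zmod_eq_zero_iff_dvd _ N).mpr ⟨n, by rw [h, mul_comm]⟩
  have h12 : γ₀ ^ 12 = 1 := PeriodRelations.pow_twelve_eq_one γ₀ (by rw [hγ₀]; simp)
  refine ⟨⟨γ₀, hmem⟩, ?_, ?_⟩
  · exact isOfFinOrder_iff_pow_eq_one.mpr ⟨12, by norm_num, Subtype.ext (by rw [Subgroup.coe_pow]; exact h12)⟩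
  · rfl

/-- **(W) at every odd level where `−1` IS a square mod `N`** (all prime factors `≡ 1 (mod 4)`): single order-`4` witness, or two
order-`4` elements built from a Dirichlet prime `ℓ ≡ 7 (mod 8)`, `ℓ ≡ √−1 (mod N)` (see the module docstring).
[cite: Manin1972, Prop. 1.4] -/
theorem flatWitnessAtTwo_of_isSquare_neg_one (N : ℕ) (hN : Odd N) (hsq : IsSquare (-1 : ZMod N)) :
    ∃ (H : Subgroup (ZMod N)ˣ) (ρ : Gamma0 N) (k : ℕ), -1 ∈ H ∧
      (∀ γ : Gamma0 N, IsOfFinOrder γ ∨ trEntry γ = 2 ∨ trEntry γ = -2 → ∃ u ∈ H, (u : ZMod N) = Gamma0Map N γ) ∧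
      ρ ∈ Subgroup.closure {γ : Gamma0 N | IsOfFinOrder γ ∨ trEntry γ = 2 ∨ trEntry γ = -2} ⊔ commutator (Gamma0 N) ∧
      (dEntry ρ).natAbs = 2 ^ k ∧
      ∀ e : ℕ, (∃ u ∈ H, (u : ZMod N) = 2 ^ e) → Nat.gcd k 4 ∣ e := by
  haveI : NeZero N := ⟨hN.pos.ne'⟩
  have h3N : Odd (3 * N) := (by decide : Odd 3).mul hN
  obtain ⟨i₀, hi₀⟩ := hsq
  have hi₀sq : i₀ ^ 2 = -1 := by rw [sq]; exact hi₀.symm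
  have hi₀u : IsUnit i₀ := IsUnit.of_mul_eq_one (-i₀) (by linear_combination -hi₀sq)
  set iU : (ZMod N)ˣ := hi₀u.unit with hiUdef
  have hiU : (iU : ZMod N) = i₀ := hi₀u.unit_spec
  -- `S = ⟨√−1⟩`, `H = {u : u^{3N} ∈ S}`
  set S : Subgroup (ZMod N)ˣ := Subgroup.closure {u : (ZMod N)ˣ | (u : ZMod N) ^ 2 = -1} with hSdef
  have hiUS : iU ∈ S := Subgroup.subset_closure (by show (iU : ZMod N) ^ 2 = -1; rw [hiU, hi₀sq])
  have hnegS : (-1 : (ZMod N)ˣ) ∈ S := by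
    have : (-1 : (ZMod N)ˣ) = iU * iU := Units.ext (by
      rw [Units.val_neg, Units.val_one, Units.val_mul, hiU]; linear_combination -hi₀sq)
    rw [this]; exact mul_mem hiUS hiUS
  set H : Subgroup (ZMod N)ˣ := S.comap (powMonoidHom (3 * N)) with hHdef
  have hmemH : ∀ u : (ZMod N)ˣ, u ∈ H ↔ u ^ (3 * N) ∈ S := fun u => by
    rw [hHdef, Subgroup.mem_comap, powMonoidHom_apply]
  have hneg : -1 ∈ H := by rw [hmemH, h3N.neg_pow, one_pow]; exact hnegS
  have hH : ∀ γ : Gamma0 N, IsOfFinOrder γ ∨ trEntry γ = 2 ∨ trEntry γ = -2 →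
      ∃ u ∈ H, (u : ZMod N) = Gamma0Map N γ := by
    intro γ hγ
    obtain ⟨u, hu⟩ := isUnit_Gamma0Map N γ
    refine ⟨u, ?_, hu⟩
    rw [hmemH]
    rcases gamma0Map_trichotomy_of_killed hN γ hγ with h | h | h
    · have : u ^ (3 * N) = 1 := Units.ext (by rw [Units.val_pow_eq_pow_val, hu, h, Units.val_one])
      rw [this]; exact one_mem S
    · have : u ^ (3 * N) = -1 := Units.ext (by rw [Units.val_pow_eq_pow_val, hu, h, Units.val_neg, Units.val_one])
      rw [this]; exact hnegS
    · exact S.pow_mem (Subgroup.subset_closure (by show (u : ZMod N) ^ 2 = -1; rw [hu, h])) _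
  -- the unit `2`, its order `r` modulo `H`
  have hcop : Nat.Coprime 2 N := Nat.coprime_two_left.mpr hN
  set t : (ZMod N)ˣ := ZMod.unitOfCoprime 2 hcop with htdef
  have ht : (t : ZMod N) = 2 := by rw [htdef, ZMod.coe_unitOfCoprime]; norm_num
  set q : (ZMod N)ˣ →* (ZMod N)ˣ ⧸ H := QuotientGroup.mk' H with hqdef
  set r : ℕ := orderOf (q t) with hrdef
  have htr : t ^ r ∈ H := by
    rw [← QuotientGroup.eq_one_iff, ← QuotientGroup.mk'_apply, ← hqdef, map_pow]
    exact pow_orderOf_eq_one (q t)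
  have hkey : ∀ e : ℕ, (∃ u ∈ H, (u : ZMod N) = 2 ^ e) → r ∣ e := by
    rintro e ⟨u, huH, hu⟩
    have hut : u = t ^ e := Units.ext (by rw [hu, Units.val_pow_eq_pow_val, ht])
    rw [hut] at huH
    have h1 : (q t) ^ e = 1 := by
      rw [← map_pow, hqdef, QuotientGroup.mk'_apply, QuotientGroup.eq_one_iff]
      exact huH
    exact orderOf_dvd_of_pow_eq_one h1
  -- `gcd(a·r, 4) ∣ r ∣ e` for odd `a`
  have hgcd : ∀ a : ℕ, Odd a → ∀ e : ℕ, r ∣ e → Nat.gcd (a * r) 4 ∣ e := by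
    intro a ha e he
    have h4 : Nat.gcd (a * r) 4 ∣ 4 := Nat.gcd_dvd_right _ _
    have hca : Nat.Coprime 4 a := by
      have h2 : Nat.Coprime 2 a := Nat.coprime_two_left.mpr ha
      simpa using h2.pow_left 2
    have hc : Nat.Coprime (Nat.gcd (a * r) 4) a := Nat.Coprime.coprime_dvd_left h4 hca
    exact (hc.dvd_of_dvd_mul_left (Nat.gcd_dvd_left _ _)).trans he
  -- `w = 2^{3Nr} ∈ S` has square `±1`
  have hw : (t ^ r) ^ (3 * N) ∈ S := (hmemH _).mp htr
  have hwval : (((t ^ r) ^ (3 * N) : (ZMod N)ˣ) : ZMod N) = (2 : ZMod N) ^ (3 * N * r) := by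
    rw [Units.val_pow_eq_pow_val, Units.val_pow_eq_pow_val, ht, ← pow_mul, mul_comm]
  rcases sq_mem_closure_roots hw with hw1 | hw1 <;> rw [hwval] at hw1
  swap
  · -- `w² = −1`: single elliptic witness `d = 2^{3Nr}`
    set D : ℤ := (2 : ℤ) ^ (3 * N * r) with hDdef
    have hDabs : D.natAbs = 2 ^ (3 * N * r) := by rw [hDdef, Int.natAbs_pow]; rfl
    have hx : (((D ^ 2 - 0 * D + 1 : ℤ)) : ZMod N) = 0 := by rw [hDdef]; push_cast; linear_combination hw1
    obtain ⟨c, hc⟩ := (ZMod.intCast_zmod_eq_zero_iff_dvd _ N).mp hx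
    obtain ⟨ρ, hρfin, -, hρd⟩ := exists_elliptic_dEntry N D 0 c (by rw [hc, mul_comm]) (by norm_num)
    refine flatWitnessAt_of_single H hneg hH ρ (Or.inl hρfin) (3 * N * r) (by rw [hρd, hDabs]) (fun e he => ?_)
    exact hgcd (3 * N) h3N e (hkey e he)
  · -- `w² = 1`: two elliptic elements and a Dirichlet prime
    -- a prime `ℓ ≡ 7 (mod 8)` with `ℓ ≡ i₀ (mod N)`
    have hcop8 : Nat.Coprime 8 N := by
      have h2 : Nat.Coprime 2 N := hcop
      simpa using h2.pow_left 3
    obtain ⟨a₀, ha8, haN⟩ := Nat.chineseRemainder hcop8 7 i₀.val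
    have ha₀N : (a₀ : ZMod N) = i₀ := by
      rw [← ZMod.natCast_zmod_val i₀]
      exact (ZMod.natCast_eq_natCast_iff _ _ _).mpr haN
    have ha₀unit : IsUnit (a₀ : ZMod (8 * N)) := by
      rw [ZMod.isUnit_iff_coprime]
      refine Nat.Coprime.mul_right ?_ ?_
      · have : a₀ % 8 = 7 := by have h := ha8; unfold Nat.ModEq at h; omega
        have hodd : Odd a₀ := Nat.odd_iff.mpr (by omega)
        simpa using (Nat.coprime_two_left.mpr hodd).pow_left 3 |>.symm
      · exact (ZMod.isUnit_iff_coprime a₀ N).mp (by rw [ha₀N]; exact hi₀u)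
    haveI : NeZero (8 * N) := ⟨mul_ne_zero (by norm_num) (NeZero.ne N)⟩
    obtain ⟨ℓ, hℓ2, hℓp, hℓa⟩ := Nat.forall_exists_prime_gt_and_eq_mod ha₀unit 2
    haveI : Fact ℓ.Prime := ⟨hℓp⟩
    -- `ℓ % 8 = 7` and `(ℓ : ZMod N) = i₀`
    have hℓmod : ℓ % (8 * N) = a₀ % (8 * N) := (ZMod.natCast_eq_natCast_iff' _ _ _).mp hℓa
    have hℓ8 : ℓ % 8 = 7 := by
      have h1 : ℓ % (8 * N) % 8 = a₀ % (8 * N) % 8 := by rw [hℓmod]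
      rw [Nat.mod_mul_right_mod, Nat.mod_mul_right_mod] at h1
      have : a₀ % 8 = 7 := by have h := ha8; unfold Nat.ModEq at h; omega
      omega
    have hℓN : (ℓ : ZMod N) = i₀ := by
      have h1 : ℓ % (8 * N) % N = a₀ % (8 * N) % N := by rw [hℓmod]
      rw [mul_comm, Nat.mod_mul_right_mod, Nat.mod_mul_right_mod] at h1
      rw [← ha₀N]
      exact (ZMod.natCast_eq_natCast_iff' _ _ _).mpr h1
    -- `2` is a square mod `ℓ`, so `2^m ≡ 1 (mod ℓ)` with `m = (ℓ - 1)/2` odd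
    have hℓne2 : ℓ ≠ 2 := by omega
    obtain ⟨x, hx⟩ := (ZMod.exists_sq_eq_two_iff hℓne2).mpr (Or.inr hℓ8)
    set m : ℕ := (ℓ - 1) / 2 with hmdef
    have hmodd : Odd m := Nat.odd_iff.mpr (by omega)
    have h2m : 2 * m = ℓ - 1 := by omega
    have hx0 : x ≠ 0 := by
      rintro rfl
      have h2 : (2 : ZMod ℓ) = 0 := by rw [hx, mul_zero]
      have : ((2 : ℕ) : ZMod ℓ) = 0 := by exact_mod_cast h2
      rw [ZMod.natCast_eq_zero_iff] at this
      exact hℓne2 ((Nat.prime_dvd_prime_iff_eq hℓp Nat.prime_two).mp this)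
    have h2powm : (2 : ZMod ℓ) ^ m = 1 := by
      rw [hx, ← sq, ← pow_mul, h2m]
      exact ZMod.pow_card_sub_one_eq_one hx0
    -- the exponent `k = 3N·r·m`
    set k : ℕ := 3 * N * r * m with hkdef
    have h2k_ℓ : (2 : ZMod ℓ) ^ k = 1 := by
      rw [hkdef, mul_comm (3 * N * r) m, pow_mul, h2powm, one_pow]
    have h2k_N : ((2 : ZMod N) ^ k) ^ 2 = 1 := by
      have hw1' : (2 : ZMod N) ^ (3 * N * r * 2) = 1 := by rw [pow_mul]; exact hw1
      have hk2 : k * 2 = (3 * N * r * 2) * m := by rw [hkdef]; ring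
      rw [← pow_mul, hk2, pow_mul, hw1', one_pow]
    -- integers: `ℓ ∣ 2^k - 1 = ℓ·T`, `d₂ = ℓ - T`
    set D : ℤ := (2 : ℤ) ^ k with hDdef
    have hℓdvd : (ℓ : ℤ) ∣ D - 1 := by
      rw [← ZMod.intCast_zmod_eq_zero_iff_dvd, hDdef]
      push_cast
      rw [h2k_ℓ, sub_self]
    obtain ⟨T, hT⟩ := hℓdvd
    obtain ⟨d₂, hd₂⟩ : ∃ d₂ : ℤ, d₂ = (ℓ : ℤ) - T := ⟨_, rfl⟩
    -- residues mod `N`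
    have hLN : (((ℓ : ℤ) : ℤ) : ZMod N) = i₀ := by push_cast; exact hℓN
    have hDN : (((D : ℤ)) : ZMod N) ^ 2 = 1 := by rw [hDdef]; push_cast; exact h2k_N
    have hLT : (((ℓ : ℤ) : ℤ) : ZMod N) * ((T : ℤ) : ZMod N) = ((D : ℤ) : ZMod N) - 1 := by
      have h := congrArg (fun z : ℤ => (z : ZMod N)) hT
      simp only [Int.cast_sub, Int.cast_mul, Int.cast_one] at h
      exact h.symm
    have hL1 : ∃ n₁ : ℤ, (ℓ : ℤ) ^ 2 + 1 = n₁ * N := by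
      have hx1 : ((((ℓ : ℤ) ^ 2 + 1 : ℤ)) : ZMod N) = 0 := by push_cast; rw [hℓN]; linear_combination hi₀sq
      obtain ⟨c, hc⟩ := (ZMod.intCast_zmod_eq_zero_iff_dvd _ N).mp hx1
      exact ⟨c, by rw [hc, mul_comm]⟩
    have hL2 : ∃ n₂ : ℤ, d₂ ^ 2 + 1 = n₂ * N := by
      have hTval : ((T : ℤ) : ZMod N) = -i₀ * (((D : ℤ) : ZMod N) - 1) := by
        linear_combination (-i₀) * hLT + (i₀ * ((T : ℤ) : ZMod N)) * hLN + ((T : ℤ) : ZMod N) * hi₀sq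
      have hx2 : (((d₂ ^ 2 + 1 : ℤ)) : ZMod N) = 0 := by
        rw [hd₂]; push_cast; rw [hℓN, hTval]
        linear_combination (((D : ℤ) : ZMod N) ^ 2) * hi₀sq - hDN
      obtain ⟨c, hc⟩ := (ZMod.intCast_zmod_eq_zero_iff_dvd _ N).mp hx2
      exact ⟨c, by rw [hc, mul_comm]⟩
    obtain ⟨n₁, hn₁⟩ := hL1
    obtain ⟨n₂, hn₂⟩ := hL2
    obtain ⟨ε₁, hfin₁, hε₁⟩ := exists_ell4 N (ℓ : ℤ) n₁ hn₁
    obtain ⟨ε₂, hfin₂, hε₂⟩ := exists_ell4 N d₂ n₂ hn₂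
    -- the witness `ρ = ε₁ ε₂`, `d(ρ) = -2^k`
    have hdρ : dEntry (ε₁ * ε₂) = -D := by
      show (((ε₁ * ε₂ : Gamma0 N) : SL(2, ℤ)) : Matrix (Fin 2) (Fin 2) ℤ) 1 1 = -D
      rw [Subgroup.coe_mul, Matrix.SpecialLinearGroup.coe_mul, hε₁, hε₂]
      simp only [Fin.isValue, Matrix.mul_apply, Fin.sum_univ_two, Matrix.of_apply, Matrix.cons_val',
        Matrix.cons_val_zero, Matrix.cons_val_one, Matrix.cons_val_fin_one]
      linear_combination hT + (ℓ : ℤ) * hd₂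
    refine ⟨H, ε₁ * ε₂, k, hneg, hH, ?_, ?_, fun e he => ?_⟩
    · exact Subgroup.mem_sup_left (mul_mem (Subgroup.subset_closure (Or.inl hfin₁))
        (Subgroup.subset_closure (Or.inl hfin₂)))
    · rw [hdρ, Int.natAbs_neg, hDdef, Int.natAbs_pow]; rfl
    · have hk' : k = (3 * N * m) * r := by rw [hkdef]; ring
      rw [hk']
      exact hgcd (3 * N * m) (h3N.mul hmodd) e (hkey e he)

/-- **(W) — the flat witness at EVERY odd level**, assembled from the prime levels (`flatWitnessAtTwo_prime`), `N = 1`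
(`flatWitnessAtTwo_one`), the levels where `−1` is not a square (`flatWitnessAtTwo_of_not_isSquare_neg_one`) and the levels
where it is (`flatWitnessAtTwo_of_isSquare_neg_one`). [cite: Manin1972, Prop. 1.4] -/
theorem flatWitnessAtTwo : ∀ N : ℕ, Odd N →
    ∃ (H : Subgroup (ZMod N)ˣ) (ρ : Gamma0 N) (k : ℕ), -1 ∈ H ∧
      (∀ γ : Gamma0 N, IsOfFinOrder γ ∨ trEntry γ = 2 ∨ trEntry γ = -2 → ∃ u ∈ H, (u : ZMod N) = Gamma0Map N γ) ∧
      ρ ∈ Subgroup.closure {γ : Gamma0 N | IsOfFinOrder γ ∨ trEntry γ = 2 ∨ trEntry γ = -2} ⊔ commutator (Gamma0 N) ∧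
      (dEntry ρ).natAbs = 2 ^ k ∧
      ∀ e : ℕ, (∃ u ∈ H, (u : ZMod N) = 2 ^ e) → Nat.gcd k 4 ∣ e :=
  flatWitnessAtTwo_of_residual (fun N hN _ _ hsq => flatWitnessAtTwo_of_isSquare_neg_one N hN hsq)

/-- **The registered stub `stub_flatWitnessAtTwoComposite` of skeleton v9** (line `kato-free-lower-sandwich-two`, crux
`OrdMissingLowerBoundAtTwo`), verbatim: (W) at the composite odd levels `N > 1` — a special case of `flatWitnessAtTwo`.
[cite: Manin1972, Prop. 1.4] -/
theorem stub_flatWitnessAtTwoComposite : ∀ N : ℕ, Odd N → 1 < N → ¬ N.Prime →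
    ∃ (H : Subgroup (ZMod N)ˣ) (ρ : Gamma0 N) (k : ℕ), -1 ∈ H ∧
      (∀ γ : Gamma0 N, IsOfFinOrder γ ∨ trEntry γ = 2 ∨ trEntry γ = -2 → ∃ u ∈ H, (u : ZMod N) = Gamma0Map N γ) ∧
      ρ ∈ Subgroup.closure {γ : Gamma0 N | IsOfFinOrder γ ∨ trEntry γ = 2 ∨ trEntry γ = -2} ⊔ commutator (Gamma0 N) ∧
      (dEntry ρ).natAbs = 2 ^ k ∧
      ∀ e : ℕ, (∃ u ∈ H, (u : ZMod N) = 2 ^ e) → Nat.gcd k 4 ∣ e :=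
  fun N hN _ _ => flatWitnessAtTwo N hN

end Square

end Summit.BirchSwinnertonDyer.BirchSwinnertonDyer.Theorems.FlatWitnessTwo
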